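/-
Copyright (c) 2026 the pub-hodgecm-mathlib formalisation cell (harness21).  Prover seat hodgecm-mathlib-LH4-p12 (g4), Track A «(D-RAM) FOUR-FRAME», unit U2H, the census leaf
(ρ2b′-X) `stub_U2H_fixedPointCensus_typeTwo_unit0` — RHO2BX-ORDER v1 (payer LH4-p14 (g3)) organ O-Cone, the LEVEL-`b` TRANSPORT, direction «OUT»: a depth-refined level-`b`
member of the line model is the W-part of a cone member (T2b's binders).  2026-09-04.
-/
import Literature.NumberTheory.Automorphic.EllipticPlaneAsFieldLine                      -- ★ p857215 (C) + ★ p857203 (D1)–(D4)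
import Literature.NumberTheory.LocalFields.QuadraticOrderDiscriminantModule              -- ★ p857276 (A)(B)(C′)
import Summits.HodgeConjecture.HodgeConjecture.Theorems.F0P3cDyRamWSideOrderCensus       -- ★ p857271 (W1)–(W4); brings ★ DEFS leaf p857239 (`IsOrd`, `dualGen`, `levelSet`, `levelSetDep`)
import HarnessLib

/-!
# Crux `H413`, line LH4 «(D-RAM) FOUR-FRAME», leaf (ρ2b′-X) — organ O-Cone, LEVEL-`b` TRANSPORT «OUT»: every `Λ ∈ levelSetDep(j, b; lam − jE u)` with `lam ∈ 𝒪_j` is `φ(B)`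
# for a `γ₂`-fixed full lattice `B ⊂ E²` carrying the glue-fibre binders of ★ T2b — dual generator `w₀ := φ⁻¹(y⁻¹x₀)` with (G1) `B = B^♯ ∩ {|⟨w₀,·⟩| ≤ 1}`,
# `B^♯ = B + 𝒪w₀`, `|⟨w₀,w₀⟩|·|ϖ|^{2b} = 1`, and the tube criterion `γ₂w₀ − u•w₀ ∈ B`

Cell `hodgecm-mathlib` (D-0151), FLOOR 0, crux H413 = `stmt-HodgeConjecture-24833`, unit U2H, leaf (ρ2b′-X) (OPEN-CONFIRMED, T18-55); RHO2BX-ORDER v1 organ **O-Cone** (LH4-p12 (g4) +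
F0P3a-p01 (g32)); statement-first HEAD `F0/P3c/LH4/LH4-p12/g4/t3/F0P3cDyRamConeLevelTransport.HEAD.v1` 141ee991 sentence (L←).  THEOREMS ONLY (no `def`, no instance, no notation, no
`sorry`); lane `--supports stmt-HodgeConjecture-24833 --as helper` (count-neutral).  WHY: the payer's integer interface hOrg (★ T6 layer 4 p857277) needs the G-side count
`N t = #{M self-dual : tM = M}` = AXIS TERM (★ (z1-d) ∘ ★ (C) ∘ ★ (W4): `Σ_j [lam ∈ 𝒪_j]·#levelSet(j,0)`) `+ Σ_{b ≥ 1}` CONE TERMS; a cone member `M` at tube coordinate `b` is a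
gluing of its W-part `B = M ∩ W` along a dual generator `w₀` (★ T2a `UnitaryLatticeTreeBlockGlueFibre`), the fibre over `(B, b)` is counted by ★ T2b
(`ncard_glueFibre_eq_natCard_normFibre`, binders `hG1`, `hw₀`, frame) and its `Γ`-fixed part by T2c (LH4-p05 (g4)); THIS FILE + its twin «IN» identify the INDEX SET of that sum —
the W-parts `B` at tube `b` whose fibre contains a `Γ`-fixed member — with `⋃_j levelSetDep(j, b; lam − jE u) ∩ {lam ∈ 𝒪_j}` of the line model (★ DEFS leaf), so that T5a∕b∕c's
depth-refined tables `#levelSetDep` (LH4-p08 ∕ F0P3-p01 ∕ LH4-p06 (g4)) are what the cone sum reads.  Direction here: M-side ⇒ W-side.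
* §1 FOUR IDENTITIES on the line model (`y = h·x₀Θx₀·c(α − ρα)`, `w₀′ = y⁻¹x₀`): (K1) `h·Θ(w₀′)·(x₀z) = z∕Θ(c(α − ρα))`; (K2) `Tr(z∕Θ(c(α − ρα))) = (z − ρz)∕Θ(c(α − ρα))` — so
  **`|⟨w₀′, x₀z⟩| ≤ 1 ⟺ |z − ρz| ≤ |c(α − ρα)|`**, the ρ-clause of `IsOrd`; (K3) Θ-symmetry `|Tr(hΘ(m)a)| = |Tr(hΘ(a)m)|`; (K4) `Tr(hΘ(a)(t·m)) = t·Tr(hΘ(a)m)` for fixed `t`.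
* §2 (C′≤) `v_herm_dualGen_inv_mul_sq_eq_one_of_le` — ★ (C′) with `|cα| ≤ 1` in place of `< 1` (covers the maximal order `j = 0` of an unramified `M∕E`).
* §3 **(L←) `exists_coneData_of_mem_levelSetDep`**.
HONEST LABEL: count-neutral; HC_CM is proved only modulo the 7 printed citations (2 remaining named inputs: hLiu418 = `stmt-HodgeConjecture-24832`, h413 = `stmt-HodgeConjecture-24833`) until
rung 0 closes.

FRAME = ★ T3-T (C)'s binders (`σ hvσ ϖ hϖ0 hϖ1 H₂ hH₂ jE ρ Θ α hρρ hvρ hα hα1 hint hjv hjfix φ hφs hφi hφo γ₂ lam h hφγ hlam hform`) + `hΘΘ hΘρ hvΘ hΘh` + the VALUE DICTIONARY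
`hjpow : |jE t| = |jE ϖ|^n ↔ |t| = |ϖ|^n` (`n : ℤ`) + `hϖmax` (`|jE ϖ|` is the largest fixed value below `1`) + the `U(1)`-part `u : E`.

## References
* [Kottwitz1986BaseChangeUnits] R. E. Kottwitz, *Base change for unit elements of Hecke algebras*, Compositio Math. 60 (1986), §1 pp. 240–241.
* [Jacobowitz1962] R. Jacobowitz, *Hermitian forms over local fields*, Amer. J. Math. 84 (1962), §4 (duals, modular components, gluing).
* [BruhatTits1972] F. Bruhat, J. Tits, *Groupes réductifs sur un corps local I*, Publ. Math. IHÉS 41 (1972), §10.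
-/

set_option autoImplicit false

noncomputable section

open scoped Valued WithZero Matrix MatrixGroups
open WithZero
open scoped Classical
open Literature.NumberTheory.Automorphic Literature.NumberTheory.Automorphic.HermitianLattice Literature.NumberTheory.Automorphic.UnitaryLatticeTree
open Literature.NumberTheory.Automorphic.EllipticPlaneAsFieldLine
open Literature.NumberTheory.LocalFields.QuadraticOrder
open Summit.HodgeConjecture.HodgeConjecture.Cruxes.H413.F0P3cDyRamToricCensusDefs

namespace Summit.HodgeConjecture.HodgeConjecture.Cruxes.H413.F0P3cDyRamConeLevelTransport

variable {E M : Type*} [Field E] [Valued E ℤᵐ⁰] [Field M] [Valued M ℤᵐ⁰] {ρ Θ : M →+* M} {α : M}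

/-! ## §1 Four identities on the line model -/

omit [Valued M ℤᵐ⁰] in
/-- **(K1)** `h·Θ(y⁻¹x₀)·(x₀·z) = z ∕ Θ(c(α − ρα))` for `y = h·x₀Θx₀·c(α − ρα)` (`Θh = h`, `ΘΘ = id`). [cite: Jacobowitz1962, §4] -/
theorem herm_dualGen_inv_mul_eq (hα : ρ α ≠ α) (hΘΘ : ∀ x, Θ (Θ x) = x) {c : M} (hc0 : c ≠ 0) {h : M} (hΘh : Θ h = h) (hh : h ≠ 0) {x₀ : M} (hx₀ : x₀ ≠ 0) (z : M) :
    h * Θ ((h * (x₀ * Θ x₀) * (c * (α - ρ α)))⁻¹ * x₀) * (x₀ * z) = z / Θ (c * (α - ρ α)) := by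
  have hd : α - ρ α ≠ 0 := sub_ne_zero.2 (Ne.symm hα)
  have hΘx₀ : Θ x₀ ≠ 0 := (map_ne_zero Θ).2 hx₀
  have hΘcd : Θ (c * (α - ρ α)) ≠ 0 := (map_ne_zero Θ).2 (mul_ne_zero hc0 hd)
  have hΘy : Θ (h * (x₀ * Θ x₀) * (c * (α - ρ α))) = h * (Θ x₀ * x₀) * Θ (c * (α - ρ α)) := by
    rw [map_mul Θ (h * (x₀ * Θ x₀)) (c * (α - ρ α)), map_mul Θ h, map_mul Θ x₀, hΘh, hΘΘ]
  rw [map_mul Θ, map_inv₀, hΘy]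
  field_simp

omit [Valued M ℤᵐ⁰] in
/-- **(K2)** `Tr(z ∕ Θ(c(α − ρα))) = (z − ρz) ∕ Θ(c(α − ρα))` (`ρΘ(c(α − ρα)) = −Θ(c(α − ρα))`). [cite: Jacobowitz1962, §4] -/
theorem div_add_map_div_eq (hρρ : ∀ x, ρ (ρ x) = x) (hΘρ : ∀ x, Θ (ρ x) = ρ (Θ x)) {c : M} (hc : ρ c = c) (z : M) :
    z / Θ (c * (α - ρ α)) + ρ (z / Θ (c * (α - ρ α))) = (z - ρ z) / Θ (c * (α - ρ α)) := by
  have hρΘ : ρ (Θ (c * (α - ρ α))) = -Θ (c * (α - ρ α)) := by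
    rw [← hΘρ, map_mul ρ, hc, map_sub_map_eq_neg hρρ, mul_neg, map_neg]
  rw [map_div₀, hρΘ, div_neg, ← sub_eq_add_neg, sub_div]

/-- **(K1)+(K2): `|⟨w₀′, x₀z⟩| ≤ 1 ⟺ |z − ρz| ≤ |c(α − ρα)|`** — pairing with the dual generator reads the `ρ`-clause of the order. [cite: Jacobowitz1962, §4] -/
theorem v_herm_dualGen_inv_mul_le_one_iff (hρρ : ∀ x, ρ (ρ x) = x) (hα : ρ α ≠ α) (hΘΘ : ∀ x, Θ (Θ x) = x) (hΘρ : ∀ x, Θ (ρ x) = ρ (Θ x))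
    (hvΘ : ∀ x, Valued.v (Θ x) = Valued.v x) {c : M} (hc : ρ c = c) (hc0 : c ≠ 0) {h : M} (hΘh : Θ h = h) (hh : h ≠ 0) {x₀ : M} (hx₀ : x₀ ≠ 0) (z : M) :
    Valued.v (h * Θ ((h * (x₀ * Θ x₀) * (c * (α - ρ α)))⁻¹ * x₀) * (x₀ * z) +
        ρ (h * Θ ((h * (x₀ * Θ x₀) * (c * (α - ρ α)))⁻¹ * x₀) * (x₀ * z))) ≤ 1 ↔
      Valued.v (z - ρ z) ≤ Valued.v (c * (α - ρ α)) := by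
  have hd : α - ρ α ≠ 0 := sub_ne_zero.2 (Ne.symm hα)
  have hvcd : Valued.v (c * (α - ρ α)) ≠ 0 := (Valuation.ne_zero_iff _).2 (mul_ne_zero hc0 hd)
  rw [herm_dualGen_inv_mul_eq hα hΘΘ hc0 hΘh hh hx₀, div_add_map_div_eq hρρ hΘρ hc, map_div₀, hvΘ, div_le_iff₀ (zero_lt_iff.2 hvcd), one_mul]

omit [Valued M ℤᵐ⁰] in
/-- **(K3) Θ-SYMMETRY**: `h·Θ(m)·a = Θ(h·Θ(a)·m)` (`Θh = h`, `ΘΘ = id`), hence `Tr(hΘ(m)a) = Θ(Tr(hΘ(a)m))`. [cite: Jacobowitz1962, §4] -/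
theorem herm_swap_eq (hΘΘ : ∀ x, Θ (Θ x) = x) (hΘρ : ∀ x, Θ (ρ x) = ρ (Θ x)) {h : M} (hΘh : Θ h = h) (m a : M) :
    h * Θ m * a + ρ (h * Θ m * a) = Θ (h * Θ a * m + ρ (h * Θ a * m)) := by
  rw [map_add, hΘρ, map_mul Θ, map_mul Θ, hΘh, hΘΘ]; ring_nf

/-- **(K3)** `|Tr(hΘ(m)a)| = |Tr(hΘ(a)m)|`. [cite: Jacobowitz1962, §4] -/
theorem v_herm_swap (hΘΘ : ∀ x, Θ (Θ x) = x) (hΘρ : ∀ x, Θ (ρ x) = ρ (Θ x)) (hvΘ : ∀ x, Valued.v (Θ x) = Valued.v x) {h : M} (hΘh : Θ h = h) (m a : M) :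
    Valued.v (h * Θ m * a + ρ (h * Θ m * a)) = Valued.v (h * Θ a * m + ρ (h * Θ a * m)) := by
  rw [herm_swap_eq hΘΘ hΘρ hΘh, hvΘ]

omit [Valued M ℤᵐ⁰] in
/-- **(K4) E-LINEARITY** in the second variable: `Tr(hΘ(a)(t·m)) = t·Tr(hΘ(a)m)` for `ρt = t`. [cite: Jacobowitz1962, §4] -/
theorem herm_fixed_mul_eq {t : M} (ht : ρ t = t) (h a m : M) : h * Θ a * (t * m) + ρ (h * Θ a * (t * m)) = t * (h * Θ a * m + ρ (h * Θ a * m)) := by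
  rw [map_mul ρ (h * Θ a) (t * m), map_mul ρ t m, ht, map_mul ρ (h * Θ a) m]; ring

omit [Valued M ℤᵐ⁰] in
/-- **(K4′)** in the first variable: `Tr(hΘ(t·a)m) = Θ(t)·Tr(hΘ(a)m)` for `ρt = t` (`Θt` is again fixed: `Θρ = ρΘ`). [cite: Jacobowitz1962, §4] -/
theorem herm_fixed_mul_left_eq (hΘρ : ∀ x, Θ (ρ x) = ρ (Θ x)) {t : M} (ht : ρ t = t) (h a m : M) :
    h * Θ (t * a) * m + ρ (h * Θ (t * a) * m) = Θ t * (h * Θ a * m + ρ (h * Θ a * m)) := by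
  have hΘt : ρ (Θ t) = Θ t := by rw [← hΘρ, ht]
  rw [map_mul Θ t a, show h * (Θ t * Θ a) * m = Θ t * (h * Θ a * m) by ring, map_mul ρ (Θ t), hΘt]; ring

/-! ## §2 (C′≤): the dual generator pairs to `|y|⁻²` whenever `|cα| ≤ 1` -/

/-- **(C′≤)** — ★ `v_herm_dualGen_inv_mul_sq_eq_one` with the strictness `|cα| < 1` relaxed to `|cα| ≤ 1` (if `|q| < 1` then `|q·cα| < 1` anyway): for a primitive `y = p + q·(cα)`
with `|y| < 1`, `|⟨y⁻¹x₀, y⁻¹x₀⟩|·|y|² = 1`. [cite: Jacobowitz1962, §4] -/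
theorem v_herm_dualGen_inv_mul_sq_eq_one_of_le (hρρ : ∀ x, ρ (ρ x) = x) (hvρ : ∀ x, Valued.v (ρ x) = Valued.v x) (hα : ρ α ≠ α)
    (hΘΘ : ∀ x, Θ (Θ x) = x) (hΘρ : ∀ x, Θ (ρ x) = ρ (Θ x)) (hvΘ : ∀ x, Valued.v (Θ x) = Valued.v x)
    {c : M} (hc : ρ c = c) (hc0 : c ≠ 0) {h : M} (hΘh : Θ h = h) (hh : h ≠ 0) {x₀ : M} (hx₀ : x₀ ≠ 0)
    {p q : M} (hp : ρ p = p) (hq : ρ q = q) (hq1 : Valued.v q ≤ 1) (hprim : Valued.v p = 1 ∨ Valued.v q = 1)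
    (hy : h * (x₀ * Θ x₀) * (c * (α - ρ α)) = p + q * (c * α)) (hcα : Valued.v (c * α) ≤ 1) (hy1 : Valued.v (h * (x₀ * Θ x₀) * (c * (α - ρ α))) < 1) :
    Valued.v (h * Θ ((h * (x₀ * Θ x₀) * (c * (α - ρ α)))⁻¹ * x₀) * ((h * (x₀ * Θ x₀) * (c * (α - ρ α)))⁻¹ * x₀) +
        ρ (h * Θ ((h * (x₀ * Θ x₀) * (c * (α - ρ α)))⁻¹ * x₀) * ((h * (x₀ * Θ x₀) * (c * (α - ρ α)))⁻¹ * x₀))) *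
      Valued.v (h * (x₀ * Θ x₀) * (c * (α - ρ α))) ^ 2 = 1 := by
  have hd : α - ρ α ≠ 0 := sub_ne_zero.2 (Ne.symm hα)
  have hcd : c * (α - ρ α) ≠ 0 := mul_ne_zero hc0 hd
  have hΘx₀ : Θ x₀ ≠ 0 := (map_ne_zero Θ).2 hx₀
  have hy0 : h * (x₀ * Θ x₀) * (c * (α - ρ α)) ≠ 0 := mul_ne_zero (mul_ne_zero hh (mul_ne_zero hx₀ hΘx₀)) hcd
  have hvy : Valued.v (h * (x₀ * Θ x₀) * (c * (α - ρ α))) ≠ 0 := (Valuation.ne_zero_iff _).2 hy0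
  have hvcd : Valued.v (c * (α - ρ α)) ≠ 0 := (Valuation.ne_zero_iff _).2 hcd
  -- `|q| = 1`: otherwise `|p| = 1` and `|y| = 1`
  have hqu : Valued.v q = 1 := by
    rcases hprim with hpu | hqu
    · by_contra hqu
      have hqlt : Valued.v q < 1 := lt_of_le_of_ne hq1 hqu
      have hsmall : Valued.v (q * (c * α)) < 1 := by
        rw [map_mul]
        calc Valued.v q * Valued.v (c * α) ≤ Valued.v q * 1 := mul_le_mul' le_rfl hcα
          _ = Valued.v q := mul_one _
          _ < 1 := hqlt
      have hval : Valued.v (p + q * (c * α)) = 1 := by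
        rw [Valuation.map_add_of_distinct_val _ (by rw [hpu]; exact hsmall.ne'), hpu, max_eq_left hsmall.le]
      rw [← hy] at hval
      rw [hval] at hy1
      exact lt_irrefl _ hy1
    · exact hqu
  have hdepth : Valued.v (h * (x₀ * Θ x₀) * (c * (α - ρ α)) - ρ (h * (x₀ * Θ x₀) * (c * (α - ρ α)))) = Valued.v (c * (α - ρ α)) := by
    rw [hy]; exact v_sub_map_eq_of_coord_unit hc hp hq hqu
  rw [v_herm_dualGen_inv_eq hρρ hvρ hα hΘΘ hΘρ hvΘ hc hc0 hΘh hh hx₀, hdepth, div_mul_eq_mul_div,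
    div_eq_iff (mul_ne_zero (pow_ne_zero 2 hvy) hvcd), one_mul]
  exact mul_comm _ _

/-! ## §3 (L←) A depth-refined level-`b` member is the W-part of a cone member -/

/-- **(L←) `exists_coneData_of_mem_levelSetDep`.**  Every `Λ ∈ levelSetDep(j, b; lam − jE u)` (`b ≥ 1`) with `lam ∈ 𝒪_j` is `φ(B)` for a full lattice `B = g·𝒪² ⊂ E²` with
`γ₂B = B` and a dual generator `w₀` (`:= φ⁻¹(y⁻¹x₀)`) satisfying T2b's binders: (G1) `w ∈ B ⟺ w ∈ B^♯ ∧ |⟨w₀,w⟩| ≤ 1`, the generation `B^♯ = B + 𝒪·w₀`, `|⟨w₀,w₀⟩|·|ϖ|^{2b} = 1`,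
and the tube criterion `γ₂w₀ − u•w₀ ∈ B`. [cite: Jacobowitz1962, §4] [cite: Kottwitz1986BaseChangeUnits, §1 pp. 240–241] [cite: BruhatTits1972, §10] -/
theorem exists_coneData_of_mem_levelSetDep (σ : E →+* E) {ϖ : E} (hϖ0 : ϖ ≠ 0) (hϖ1 : Valued.v ϖ < 1)
    (H₂ : Matrix (Fin 2) (Fin 2) E) (jE : E →+* M)
    (hρρ : ∀ x, ρ (ρ x) = x) (hvρ : ∀ x, Valued.v (ρ x) = Valued.v x) (hα : ρ α ≠ α) (hα1 : Valued.v α ≤ 1)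
    (hint : ∀ z : M, Valued.v z ≤ 1 → Valued.v ((z - ρ z) / (α - ρ α)) ≤ 1)
    (hΘΘ : ∀ x, Θ (Θ x) = x) (hΘρ : ∀ x, Θ (ρ x) = ρ (Θ x)) (hvΘ : ∀ x, Valued.v (Θ x) = Valued.v x)
    (hjv : ∀ c, Valued.v (jE c) ≤ 1 ↔ Valued.v c ≤ 1) (hjfix : ∀ z, ρ z = z ↔ ∃ c, jE c = z)
    (hjpow : ∀ (t : E) (n : ℤ), Valued.v (jE t) = Valued.v (jE ϖ) ^ n ↔ Valued.v t = Valued.v ϖ ^ n)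
    (hϖmax : ∀ t : M, ρ t = t → Valued.v t < 1 → Valued.v t ≤ Valued.v (jE ϖ))
    (φ : (Fin 2 → E) →+ M) (hφs : ∀ (c : E) (x : Fin 2 → E), φ (c • x) = jE c * φ x) (hφi : Function.Injective φ) (hφo : Function.Surjective φ)
    {γ₂ : GL (Fin 2) E} {lam h : M} (hφγ : ∀ x, φ ((γ₂ : Matrix (Fin 2) (Fin 2) E).mulVec x) = lam * φ x) (hlam : Valued.v lam = 1)
    (hΘh : Θ h = h) (hh : h ≠ 0) (hform : ∀ x y, jE (pairing σ H₂ x y) = h * Θ (φ x) * φ y + ρ (h * Θ (φ x) * φ y))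
    (u : E) {b : ℕ} (hb : 1 ≤ b) {j : ℕ} {Λ : AddSubgroup M}
    (hΛ : Λ ∈ levelSetDep ρ Θ α (jE ϖ) h j b (lam - jE u)) (hlamj : IsOrd ρ α (jE ϖ ^ j) lam) :
    ∃ B : Submodule 𝒪[E] (Fin 2 → E), B.toAddSubgroup.map φ = Λ ∧ (∃ g : GL (Fin 2) E, B = latt (g : Matrix (Fin 2) (Fin 2) E)) ∧ mapGL γ₂ B = B ∧
      ∃ w₀ : Fin 2 → E, (∀ w, w ∈ B ↔ (w ∈ dualLatt σ H₂ B ∧ Valued.v (pairing σ H₂ w₀ w) ≤ 1)) ∧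
        (∀ w ∈ dualLatt σ H₂ B, ∃ (t : E) (a : Fin 2 → E), Valued.v t ≤ 1 ∧ a ∈ B ∧ w = t • w₀ + a) ∧
        Valued.v (pairing σ H₂ w₀ w₀) * Valued.v ϖ ^ (2 * b) = 1 ∧ (γ₂ : Matrix (Fin 2) (Fin 2) E).mulVec w₀ - u • w₀ ∈ B := by
  -- unpack the level-set data; work with the EXPANDED dual generator `Y = h·(x₀Θx₀)·(c(α − ρα))`
  obtain ⟨⟨x₀, hx₀, hΛx, hyO, hyprim, hylev⟩, hdepΛ⟩ := hΛ
  rw [dualGen_def] at hyO hyprim hylev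
  set ϖE : M := jE ϖ with hϖE
  set c : M := ϖE ^ j with hcdef
  have hρϖ : ρ ϖE = ϖE := (hjfix ϖE).2 ⟨ϖ, rfl⟩
  have hϖE0 : ϖE ≠ 0 := (map_ne_zero jE).2 hϖ0
  have hϖE1 : Valued.v ϖE < 1 := by
    refine lt_of_le_of_ne ((hjv ϖ).2 hϖ1.le) fun hle => ?_
    have := (hjpow ϖ 0).1 (by rw [zpow_zero]; exact hle)
    rw [zpow_zero] at this
    exact hϖ1.ne this
  have hc : ρ c = c := by rw [hcdef, map_pow, hρϖ]
  have hc0 : c ≠ 0 := pow_ne_zero j hϖE0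
  have hc1 : Valued.v c ≤ 1 := by rw [hcdef, map_pow]; exact pow_le_one₀ zero_le hϖE1.le
  have hd : α - ρ α ≠ 0 := sub_ne_zero.2 (Ne.symm hα)
  have hΘx₀ : Θ x₀ ≠ 0 := (map_ne_zero Θ).2 hx₀
  have hY0 : h * (x₀ * Θ x₀) * (c * (α - ρ α)) ≠ 0 := mul_ne_zero (mul_ne_zero hh (mul_ne_zero hx₀ hΘx₀)) (mul_ne_zero hc0 hd)
  have hvY0 : Valued.v (h * (x₀ * Θ x₀) * (c * (α - ρ α))) ≠ 0 := (Valuation.ne_zero_iff _).2 hY0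
  have hvYpos : 0 < Valued.v (h * (x₀ * Θ x₀) * (c * (α - ρ α))) := zero_lt_iff.2 hvY0
  have hρY0 : ρ (h * (x₀ * Θ x₀) * (c * (α - ρ α))) ≠ 0 := (map_ne_zero ρ).2 hY0
  -- the coordinates of `Y` and primitivity in coordinates
  obtain ⟨p, q, ⟨hp, hp1⟩, ⟨hq, hq1⟩, hypq⟩ := (exists_fixed_coords_iff_mem_order hρρ hα hα1 hint hc hc0 hc1 _).2 hyO
  have hprim : Valued.v p = 1 ∨ Valued.v q = 1 := by
    by_contra hcon
    push Not at hcon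
    apply hyprim
    have hlt : Valued.v p < 1 ∧ Valued.v q < 1 := ⟨lt_of_le_of_ne hp1 hcon.1, lt_of_le_of_ne hq1 hcon.2⟩
    have := (div_mem_order_iff_coords_lt_one hρρ hα hα1 hint hc hc0 hc1 hρϖ hϖE0 hϖE1 hϖmax hp hq).2 hlt
    rw [← hypq] at this
    exact this
  -- `|Y| < 1` (level `b ≥ 1`), `|cα| ≤ 1`, exact `ρ`-depth
  have hylt : Valued.v (h * (x₀ * Θ x₀) * (c * (α - ρ α))) < 1 := by
    rw [hylev]
    calc Valued.v ϖE ^ b ≤ Valued.v ϖE ^ 1 := pow_le_pow_right_of_le_one' hϖE1.le hb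
      _ = Valued.v ϖE := pow_one _
      _ < 1 := hϖE1
  have hcα : Valued.v (c * α) ≤ 1 := by rw [map_mul]; exact mul_le_one' hc1 hα1
  have hqu : Valued.v q = 1 := by
    rcases hprim with hpu | hqu
    · by_contra hqu
      have hqlt : Valued.v q < 1 := lt_of_le_of_ne hq1 hqu
      have hsmall : Valued.v (q * (c * α)) < 1 := by
        rw [map_mul]
        calc Valued.v q * Valued.v (c * α) ≤ Valued.v q * 1 := mul_le_mul' le_rfl hcα
          _ = Valued.v q := mul_one _
          _ < 1 := hqlt
      have hval : Valued.v (p + q * (c * α)) = 1 := by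
        rw [Valuation.map_add_of_distinct_val _ (by rw [hpu]; exact hsmall.ne'), hpu, max_eq_left hsmall.le]
      rw [← hypq] at hval
      exact absurd hval hylt.ne
    · exact hqu
  have hdepth : Valued.v (h * (x₀ * Θ x₀) * (c * (α - ρ α)) - ρ (h * (x₀ * Θ x₀) * (c * (α - ρ α)))) = Valued.v (c * (α - ρ α)) := by
    rw [hypq]; exact v_sub_map_eq_of_coord_unit hc hp hq hqu
  -- the lattice `B` and its `γ₂`-stability
  obtain ⟨g, hg⟩ := exists_latt_map_eq_of_order jE hρρ hα hα1 hint hjv hjfix φ hφs hφo hx₀ hc hc0 hc1 hΛx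
  have hstab : ∀ x ∈ Λ, lam * x ∈ Λ := (forall_mul_mem_iff_of_eq_mul_order hvρ hx₀ hΛx lam).2 hlamj
  refine ⟨latt (g : Matrix (Fin 2) (Fin 2) E), hg, ⟨g, rfl⟩, ?_, ?_⟩
  · exact (mapGL_eq_iff_forall_mul_mem jE hρρ hvρ hα hα1 hint hjv hjfix φ hφs hφi hφγ hlam g).2 (by rw [hg]; exact hstab)
  -- the dual generator `w₀ = φ⁻¹(Y⁻¹x₀)`
  obtain ⟨w₀, hw₀⟩ := hφo ((h * (x₀ * Θ x₀) * (c * (α - ρ α)))⁻¹ * x₀)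
  have hdual : ∀ w, w ∈ dualLatt σ H₂ (latt (g : Matrix (Fin 2) (Fin 2) E)) ↔ ∀ a ∈ Λ, Valued.v (h * Θ a * φ w + ρ (h * Θ a * φ w)) ≤ 1 := by
    intro w; rw [mem_dualLatt_iff_forall_v_herm_le_one σ H₂ jE ρ Θ h hjv φ hform, hg]
  have hintΛ : ∀ x ∈ Λ, ∀ x' ∈ Λ, Valued.v (h * Θ x * x' + ρ (h * Θ x * x')) ≤ 1 :=
    (forall_mem_forall_mem_v_herm_le_one_iff hρρ hvρ hα hα1 hint hΘΘ hΘρ hvΘ hc hc0 hc1 h hΛx).2 hyO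
  -- `⟨w₀, φ⁻¹(x₀z)⟩` reads the `ρ`-clause
  have hpairM : ∀ z, Valued.v (h * Θ (φ w₀) * (x₀ * z) + ρ (h * Θ (φ w₀) * (x₀ * z))) ≤ 1 ↔ Valued.v (z - ρ z) ≤ Valued.v (c * (α - ρ α)) := by
    intro z; rw [hw₀]; exact v_herm_dualGen_inv_mul_le_one_iff hρρ hα hΘΘ hΘρ hvΘ hc hc0 hΘh hh hx₀ z
  -- the self-pairing of `w₀`: `|⟨w₀,w₀⟩|·|Y|² = 1`
  have hmain : Valued.v (h * Θ (φ w₀) * φ w₀ + ρ (h * Θ (φ w₀) * φ w₀)) * Valued.v (h * (x₀ * Θ x₀) * (c * (α - ρ α))) ^ 2 = 1 := by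
    rw [hw₀]; exact v_herm_dualGen_inv_mul_sq_eq_one_of_le hρρ hvρ hα hΘΘ hΘρ hvΘ hc hc0 hΘh hh hx₀ hp hq hq1 hprim hypq hcα hylt
  have hww : Valued.v (h * Θ (φ w₀) * φ w₀ + ρ (h * Θ (φ w₀) * φ w₀)) = (Valued.v (h * (x₀ * Θ x₀) * (c * (α - ρ α))) ^ 2)⁻¹ :=
    eq_inv_of_mul_eq_one_left hmain
  -- the dual of `Λ` is `Λ + 𝒪'·Y⁻¹x₀` (★ (A))
  have hA := fun m => forall_mem_herm_iff_exists_add_fixed_mul hρρ hvρ hα hα1 hint hΘΘ hΘρ hvΘ hc hc0 hc1 hh hx₀ hΛx hp hp1 hq hq1 hprim hypq m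
  refine ⟨w₀, ?_, ?_, ?_, ?_⟩
  · -- (G1)
    intro w
    constructor
    · intro hwB
      have hφw : φ w ∈ Λ := by rw [← hg]; exact AddSubgroup.mem_map.2 ⟨w, hwB, rfl⟩
      obtain ⟨z, hz, hwz⟩ := (hΛx _).1 hφw
      refine ⟨(hdual w).2 fun a ha => hintΛ a ha _ hφw, ?_⟩
      rw [← hjv, hform, hwz]; exact (hpairM z).2 hz.2
    · rintro ⟨hwd, hw₀w⟩
      obtain ⟨a, t, ha, ⟨ht, ht1⟩, hφw⟩ := (hA (φ w)).1 ((hdual w).1 hwd)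
      obtain ⟨za, hza, rfl⟩ := (hΛx a).1 ha
      -- `|t·⟨w₀,w₀⟩| ≤ 1`
      have htot : Valued.v (h * Θ (φ w₀) * φ w + ρ (h * Θ (φ w₀) * φ w)) ≤ 1 := by rw [← hform, hjv]; exact hw₀w
      have h1 : Valued.v (h * Θ (φ w₀) * (x₀ * za) + ρ (h * Θ (φ w₀) * (x₀ * za))) ≤ 1 := (hpairM za).2 hza.2
      have hdiff : t * (h * Θ (φ w₀) * φ w₀ + ρ (h * Θ (φ w₀) * φ w₀)) =
          (h * Θ (φ w₀) * φ w + ρ (h * Θ (φ w₀) * φ w)) - (h * Θ (φ w₀) * (x₀ * za) + ρ (h * Θ (φ w₀) * (x₀ * za))) := by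
        rw [← herm_fixed_mul_eq ht, hφw, hw₀, mul_add, map_add]; ring
      have hterm : Valued.v t * Valued.v (h * Θ (φ w₀) * φ w₀ + ρ (h * Θ (φ w₀) * φ w₀)) ≤ 1 := by
        rw [← Valuation.map_mul, hdiff]; exact (Valuation.map_sub _ _ _).trans (max_le htot h1)
      have ht2 : Valued.v t ≤ Valued.v (h * (x₀ * Θ x₀) * (c * (α - ρ α))) ^ 2 := by
        rw [hww, ← div_eq_mul_inv, div_le_one₀ (pow_pos hvYpos 2)] at hterm; exact hterm
      -- `t∕Y ∈ 𝒪_c`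
      have hty : IsOrd ρ α c (t / (h * (x₀ * Θ x₀) * (c * (α - ρ α)))) := by
        refine ⟨?_, ?_⟩
        · rw [map_div₀, div_le_one₀ hvYpos]
          calc Valued.v t ≤ Valued.v (h * (x₀ * Θ x₀) * (c * (α - ρ α))) ^ 2 := ht2
            _ ≤ Valued.v (h * (x₀ * Θ x₀) * (c * (α - ρ α))) := by rw [sq]; exact mul_le_of_le_one_left' hylt.le
        · have hrew : t / (h * (x₀ * Θ x₀) * (c * (α - ρ α))) - ρ (t / (h * (x₀ * Θ x₀) * (c * (α - ρ α)))) =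
              t * (ρ (h * (x₀ * Θ x₀) * (c * (α - ρ α))) - h * (x₀ * Θ x₀) * (c * (α - ρ α))) /
                ((h * (x₀ * Θ x₀) * (c * (α - ρ α))) * ρ (h * (x₀ * Θ x₀) * (c * (α - ρ α)))) := by
            rw [map_div₀, ht, div_sub_div _ _ hY0 hρY0]; ring
          rw [hrew, map_div₀, Valuation.map_mul, Valuation.map_mul, hvρ, Valuation.map_sub_swap, hdepth,
            div_le_iff₀ (mul_pos hvYpos hvYpos)]
          calc Valued.v t * Valued.v (c * (α - ρ α)) ≤ Valued.v (h * (x₀ * Θ x₀) * (c * (α - ρ α))) ^ 2 * Valued.v (c * (α - ρ α)) :=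
                mul_le_mul' ht2 le_rfl
            _ = Valued.v (c * (α - ρ α)) * (Valued.v (h * (x₀ * Θ x₀) * (c * (α - ρ α))) * Valued.v (h * (x₀ * Θ x₀) * (c * (α - ρ α)))) := by
                rw [sq]; exact mul_comm _ _
      have hφwΛ : φ w ∈ Λ := by
        rw [hφw]
        refine Λ.add_mem ((hΛx _).2 ⟨za, hza, rfl⟩) ((hΛx _).2 ⟨t / (h * (x₀ * Θ x₀) * (c * (α - ρ α))), hty, ?_⟩)
        rw [div_eq_mul_inv]; ring
      rw [← hg] at hφwΛ
      obtain ⟨w', hw', hww'⟩ := AddSubgroup.mem_map.1 hφwΛ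
      rw [← hφi hww']; exact hw'
  · -- generation `B^♯ = B + 𝒪·w₀`
    intro w hwd
    obtain ⟨a, t, ha, ⟨ht, ht1⟩, hφw⟩ := (hA (φ w)).1 ((hdual w).1 hwd)
    obtain ⟨t', rfl⟩ := (hjfix t).1 ht
    have haB : a ∈ (latt (g : Matrix (Fin 2) (Fin 2) E)).toAddSubgroup.map φ := by rw [hg]; exact ha
    obtain ⟨a', ha', rfl⟩ := AddSubgroup.mem_map.1 haB
    refine ⟨t', a', (hjv t').1 ht1, ha', hφi ?_⟩
    rw [map_add, hφs, hw₀, hφw, add_comm]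
  · -- `|⟨w₀,w₀⟩|·|ϖ|^{2b} = 1`
    have hvy2 : Valued.v (h * (x₀ * Θ x₀) * (c * (α - ρ α))) ^ 2 = Valued.v ϖE ^ (2 * b) := by rw [hylev, ← pow_mul, mul_comm]
    have hval : Valued.v (jE (pairing σ H₂ w₀ w₀)) = Valued.v (jE ϖ) ^ (-((2 * b : ℕ) : ℤ)) := by
      rw [hform, hww, hvy2, ← hϖE, zpow_neg, zpow_natCast]
    have hval' := (hjpow _ _).1 hval
    rw [hval', zpow_neg, zpow_natCast, inv_mul_cancel₀ (pow_ne_zero _ ((Valuation.ne_zero_iff _).2 hϖ0))]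
  · -- the tube criterion `γ₂w₀ − u•w₀ ∈ B`
    have hdepO : IsOrd ρ α c ((lam - jE u) / (h * (x₀ * Θ x₀) * (c * (α - ρ α)))) := by
      have := (forall_herm_mul_mem_iff_isOrd_div hρρ hvρ hα hα1 hint hΘΘ hΘρ hvΘ hc hc0 hc1 hh hx₀ hΛx (lam - jE u)).1 hdepΛ
      rwa [dualGen_def] at this
    have hmem : (lam - jE u) * ((h * (x₀ * Θ x₀) * (c * (α - ρ α)))⁻¹ * x₀) ∈ Λ :=
      (hΛx _).2 ⟨(lam - jE u) / (h * (x₀ * Θ x₀) * (c * (α - ρ α))), hdepO, by rw [div_eq_mul_inv]; ring⟩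
    rw [← hg] at hmem
    obtain ⟨b', hb', hbb'⟩ := AddSubgroup.mem_map.1 hmem
    have heq : (γ₂ : Matrix (Fin 2) (Fin 2) E).mulVec w₀ - u • w₀ = b' := by
      apply hφi
      rw [map_sub, hφγ, hφs, hw₀, hbb']; ring
    rw [heq]; exact hb'

end Summit.HodgeConjecture.HodgeConjecture.Cruxes.H413.F0P3cDyRamConeLevelTransport

end
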